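import Summits.CriticalPhenomena.PercolationContinuityZ3.Theorems.Transplant.SkelFrm1RootHoldsQDKV
import Summits.CriticalPhenomena.PercolationContinuityZ3.Theorems.Transplant.SkelFrmBChoiceRootCrossY
import Summits.CriticalPhenomena.PercolationContinuityZ3.Theorems.Transplant.SkelFrmBChoiceRootClearRW
import Summits.CriticalPhenomena.PercolationContinuityZ3.Theorems.Transplant.SkelFrmBChoiceBridge0
import Summits.CriticalPhenomena.PercolationContinuityZ3.Theorems.Transplant.SkelFrmBChoiceHopFoot
import Summits.CriticalPhenomena.PercolationContinuityZ3.Theorems.Transplant.SkelFrmBChoiceRootLanding2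
import Summits.CriticalPhenomena.PercolationContinuityZ3.Theorems.Transplant.SkelFrmBChoiceRootDepthR
import Summits.CriticalPhenomena.PercolationContinuityZ3.Theorems.Transplant.SkelFrmBChoiceRootLen
import Summits.CriticalPhenomena.PercolationContinuityZ3.Theorems.Transplant.SkelFrmBParamsSlotsST
import HarnessLib

/-!
# N2 (frames-only node `SamePDropOfSkeletonFrm₁`, OPEN), (R) column: **THE SECOND-AXIS ROOT LEG FROM THE (R) VALUE ROWS** —
# `NegB.rootLegAt_frmQ3KV_snd_of_le` AT THE CHOICE FUNCTION OF RECORD `choiceAtQ3V` ((R-38) four legs: hop → bridge → x-PREFIX `Nx := 30` at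
# `(qx, Wx) := (0, 0)` → y′-corridor at its own origin `c₂ = t + (X2R, Y2R)` and across window `WxYR := WxY − X2R`, (R-46)/(R-47))

Every (R)-OWNED binder of the skeleton `NegB.rootLegAt_frmQ3KV_snd` (SkelFrm1RootHoldsQDKV) is discharged at the values of record: the prefix row set
`HKx := kgRows0_of … mk 0 0`, `Nx := 30` with `hrowP`, `reachP_le` (RootPrefix p365274), the y′ row set `HKy := kgYRows0_of … mk qxY (KS.WxYR … WxY)`
and run length `Ny := kgNYv0 … mk qxY WxY` (RootRunY p365120), the landings `c₁* = t + (X1(2n_L), Y1s)`, `c₂ = t + (X2R, Y2R)` (RootLanding2 p365411,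
`exists_landing2`), the cross links `hx := hx_0s` (bridge core 1 ⊂ prefix core 0, budget `prB0 + ℓB0 + 5R′0 + 2 ≤ kgW 0 = ⌊sL⌋` from (R-47)(b)'s
coupling `2f + 5R′0 + 3 ≤ g`) and `hx₂ := hx₂_R` (prefix last core ⊂ y′ core 0, RootCrossY), the TWO-DIMENSIONAL seed clearance `hclear₃ := hclear₃_R`
(4-way square avoidance, RootClearRW p368760 = RootClearR p365911 at `XY ≤ 100·sL`, over p5's `clear_of_kgCorrSchedY_rows4`, (R-46)(e)(f)(g)), the depth rows (`reachP_le`: `D0s + ZDP`;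
`reachRY_le`: `D2R + ZY + 13·n_L`, RootDepthR p365939), the window radius / kits / rim device / bridge exactly as on the first axis
(SkelFrm1RootHoldsQCKVOfLe), and the length row `hlen_R2` (RootLen p366001).
WHAT STAYS A HYPOTHESIS (by owner): slot floors `gFloorKG ≤ g`, `40·K·R′0 ≤ g`, `60·(Rs+1) ≤ g` ((R-46)(g)), `2f + 5R′0 + 3 ≤ g` ((R-47)(b)), `fxR0 ≤ f`,
five `ex`-floors (`r₀0 RL + 1`, `r₀0 RB0 + 1`, `Yb0 + 1`, `D0s(2n_L) + ZDP + 1`, `D2R + ZY + 13·n_L + 1`), `Px0 ⊆ Pv`; the y′ window `(qxY, WxY)` under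
`Rs + 34·n_L + 29·R′0 + 2 ≤ WxY`, `45·n_L ≤ WxY`, `3·sL ≤ qxY ≤ 20·sL`, `KGResY3` (instance `qxYQ4/WxYQ4`, stmt's Window3 rows), the y′ depth numeral
`ZY ≥ 13·reach(kgNYv0)` (instance `ZDYW`, stmt's `reachY_le_ZDYW`), the two (C)-side y′ rows `kgFarY … 0 ≤ kgTgtY0` and `kgXY … ≤ 100·sL` (era-3 value 22·sL; stmt's ArrivalYW /
CreepY3); `hRs5`; and the five READING rows of the root's boxes (`hfoot₁`, `hfoot₂` for every prefix landing over `(X1, Y1s)`, `hfoot₃`/`hlastf` for every y′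
landing over `(X2R, Y2R)`, `hDm`) — p3's reading files.
NON-VACUITY (lead g11 standing order): every discharged row is a theorem of the cited value files at the same tuple; the remaining hypotheses are exactly
the rows the thin instance feeds from stmt's union / Window3 / DepthYW / ArrivalYW / CreepY3 and p3's reading files — no floor assumed twice, no `K₀` cap,
no rate, no LEVEL-0 hypothesis.
builds on p205010 (kernel theorem, internal audit signed; external expert review pending) — nothing in this file uses p205010; nothing here is a claim
about the open node `SamePDropOfSkeletonFrm₁`.
Lane `prim-bschramm`, seat `prim-bschramm-p3` (gen 18; N2 design owner, (R) column owner); helper file (`--supports stmt-CriticalPhenomena-4575 --as helper`).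
[cite: KozmaNitzan2024, §4 p. 28 ((32) at the root), Lemma 12 (pp. 23–25)] [cite: MartineauTassion2017, §3.2 Lemma 3.5, §4.3 Lemma 4.2]
-/

noncomputable section

open MeasureTheory ProbabilityTheory
open scoped ENNReal Classical

namespace Summit.CriticalPhenomena.PercolationContinuityZ3.Theorems

namespace Transplant

open Literature.Probability.Percolation Literature.Probability.LatticeModels SimpleGraph KNCells KNLevels ChainPlanar ChainPara
open Literature.Probability.Percolation.KozmaNitzan.Cells (oth sgOf)
open Literature.Barriers.CriticalPhenomena (graphBall graphBall_mono mem_graphBall_self)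
open SkelConc (Consts)
open Skel (winGraph)
open SkelI (tanOff)
open Skelφ (rootFrame RootFootT TargetFootT RootFootV TargetFootV pgSideHalfW kgSL kgZ₀ kgZ₁ kgM₁ kgM₂ kgWm₂ kgWp₂ kgZY₀ kgZY₁ kgM₁Y kgM₂Y kgWm₂Y kgWp₂Y kgFarY kgXY)
open ChainPlanar (ScheduleNP BridgePrm BridgeOK)
open Skelφ.StepI (OutNS)

namespace PlanarSkeletonFrm

namespace NegB

open Neg

variable {κ : Consts} {V : Type} [DecidableEq V] [Countable V] {G : SimpleGraph V} [G.LocallyFinite] {Φ : PlanarSkeletonFrm G} {t : V} {p : unitInterval}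
  {hC : Φ.CylSubcritical p} {gv fv : Neg.FSlot} {Pv : PSlot} {ex mx : GSlot} {cv hv : CSlot} {bv : BSlot} {O : OutNS V} {q : unitInterval}

set_option maxHeartbeats 3200000 in
/-- **THE SECOND-AXIS ROOT LEG AT THE (V) CHOICE FUNCTION OF RECORD FROM THE (R) VALUE ROWS** — the skeleton `rootLegAt_frmQ3KV_snd` (hop → bridge →
x-prefix `Nx := 30` at `(qx, Wx) := (0, 0)` → y′-corridor at `(qxY, WxYR)`, (R-38)/(R-46)/(R-47)) with every (R)-owned binder discharged; residual = slot
floors, the y′ window caps, the depth numeral `ZY`, two (C)-side y′ rows (`farY(0) ≤ tgtY0`, `XY ≤ 100·sL`), `hRs5`, and the five reading rows.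
[cite: KozmaNitzan2024, §4 p. 28 ((32) at the root)] -/
theorem rootLegAt_frmQ3KV_snd_of_le (hAt : (choiceAtQ3V κ Φ t p Pv gv fv (SUS ex mx) cv hv bv hC).AtQNQ O q) (h1 : Φ.types = {t})
    (hp0 : 0 < (p : ℝ)) (hp1 : (p : ℝ) < 1) (mk qxY WxY ZY : ℕ)
    -- slot floors at the evaluated slots
    (hgK : gFloorKG κ Φ t p O.merged mk ≤ gOf κ Φ t p O gv) (hg2 : 40 * Neg.K κ * KS0.R'0 κ Φ t p O.merged mk ≤ gOf κ Φ t p O gv)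
    (hgR : 60 * (KS.Rs t O.merged mk + 1) ≤ gOf κ Φ t p O gv) (hfg : 2 * fOf κ Φ t p O fv + 5 * KS0.R'0 κ Φ t p O.merged mk + 3 ≤ gOf κ Φ t p O gv)
    (hf : KS.fxR0 κ Φ t p O.merged mk ≤ fOf κ Φ t p O fv)
    (hexRL : KS0.r₀0 t O.merged mk (RL κ Φ t p O gv fv) + 1 ≤ ex κ Φ t p O.merged (gOf κ Φ t p O gv) (fOf κ Φ t p O fv))
    (hexRB : KS0.r₀0 t O.merged mk (KS.RB0 κ Φ t p O.merged mk) + 1 ≤ ex κ Φ t p O.merged (gOf κ Φ t p O gv) (fOf κ Φ t p O fv))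
    (hexYb : KS.Yb0 κ Φ t p O.merged mk (gOf κ Φ t p O gv) (fOf κ Φ t p O fv) + 1 ≤ ex κ Φ t p O.merged (gOf κ Φ t p O gv) (fOf κ Φ t p O fv))
    (hexP : KS.D0s κ Φ t p O.merged mk (gOf κ Φ t p O gv) (fOf κ Φ t p O fv) (kgq κ Φ t p O.merged (gOf κ Φ t p O gv) (fOf κ Φ t p O fv) 0) + KS.ZDP κ Φ t p O.merged (gOf κ Φ t p O gv) (fOf κ Φ t p O fv) + 1 ≤ ex κ Φ t p O.merged (gOf κ Φ t p O gv) (fOf κ Φ t p O fv))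
    (hexY : KS.D2R κ Φ t p O.merged mk (gOf κ Φ t p O gv) (fOf κ Φ t p O fv) WxY + ZY + 13 * (nL κ Φ t p O.merged (gOf κ Φ t p O gv) (fOf κ Φ t p O fv)) + 1 ≤ ex κ Φ t p O.merged (gOf κ Φ t p O gv) (fOf κ Φ t p O fv))
    (hPx : (KS.Px0 mk κ Φ t p O.merged).1 ⊆ (Pv κ Φ t p O.merged).1)
    -- the y′ residual window under the Len3 caps, and the y′ depth numeral `ZY` bounding (C)'s reach at this window
    (hWxY : KS.Rs t O.merged mk + 34 * (nL κ Φ t p O.merged (gOf κ Φ t p O gv) (fOf κ Φ t p O fv)) + 29 * KS0.R'0 κ Φ t p O.merged mk + 2 ≤ WxY) (hWx45 : 45 * (nL κ Φ t p O.merged (gOf κ Φ t p O gv) (fOf κ Φ t p O fv)) ≤ WxY)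
    (hq3 : 3 * (kgSL (nL κ Φ t p O.merged (gOf κ Φ t p O gv) (fOf κ Φ t p O fv)) (ℓL κ Φ t p O.merged (gOf κ Φ t p O gv) (fOf κ Φ t p O fv)) (hL κ Φ t p O.merged (gOf κ Φ t p O gv) (fOf κ Φ t p O fv))) ≤ (qxY : ℤ)) (hqx20 : (qxY : ℤ) ≤ 20 * (kgSL (nL κ Φ t p O.merged (gOf κ Φ t p O gv) (fOf κ Φ t p O fv)) (ℓL κ Φ t p O.merged (gOf κ Φ t p O gv) (fOf κ Φ t p O fv)) (hL κ Φ t p O.merged (gOf κ Φ t p O gv) (fOf κ Φ t p O fv)))) (hxY : KGResY3 κ Φ t p O.merged (gOf κ Φ t p O gv) (fOf κ Φ t p O fv) qxY WxY)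
    (h0Y : (kgFarY (nL κ Φ t p O.merged (gOf κ Φ t p O gv) (fOf κ Φ t p O fv)) (ℓL κ Φ t p O.merged (gOf κ Φ t p O gv) (fOf κ Φ t p O fv)) (hL κ Φ t p O.merged (gOf κ Φ t p O gv) (fOf κ Φ t p O fv)) (vL κ Φ t p O.merged (gOf κ Φ t p O gv) (fOf κ Φ t p O fv)) (kgR κ Φ t p O.merged mk) 0 (kgqY κ Φ t p O.merged (gOf κ Φ t p O gv) (fOf κ Φ t p O fv) qxY) (kgWY κ Φ t p O.merged (gOf κ Φ t p O gv) (fOf κ Φ t p O fv) WxY) 0) ≤ (kgTgtY0 κ Φ t p O.merged (gOf κ Φ t p O gv) (fOf κ Φ t p O fv) mk))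
    (hXY : (kgXY (nL κ Φ t p O.merged (gOf κ Φ t p O gv) (fOf κ Φ t p O fv)) (ℓL κ Φ t p O.merged (gOf κ Φ t p O gv) (fOf κ Φ t p O fv)) (hL κ Φ t p O.merged (gOf κ Φ t p O gv) (fOf κ Φ t p O fv)) (vL κ Φ t p O.merged (gOf κ Φ t p O gv) (fOf κ Φ t p O fv)) (kgR κ Φ t p O.merged mk) 0 (kgqY κ Φ t p O.merged (gOf κ Φ t p O gv) (fOf κ Φ t p O fv) qxY) (kgWY κ Φ t p O.merged (gOf κ Φ t p O gv) (fOf κ Φ t p O fv) WxY) (kgNYv0 κ Φ t p O.merged (gOf κ Φ t p O gv) (fOf κ Φ t p O fv) mk qxY WxY)) ≤ 100 * (kgSL (nL κ Φ t p O.merged (gOf κ Φ t p O gv) (fOf κ Φ t p O fv)) (ℓL κ Φ t p O.merged (gOf κ Φ t p O gv) (fOf κ Φ t p O fv)) (hL κ Φ t p O.merged (gOf κ Φ t p O gv) (fOf κ Φ t p O fv))))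
    (hZY : 13 * ((((((kgNYv0 κ Φ t p O.merged (gOf κ Φ t p O gv) (fOf κ Φ t p O fv) mk qxY WxY) : ℕ)) : ℤ) + 1) * ((((nL κ Φ t p O.merged (gOf κ Φ t p O gv) (fOf κ Φ t p O fv)) * (ℓL κ Φ t p O.merged (gOf κ Φ t p O gv) (fOf κ Φ t p O fv)) / Skelφ.shearUnit (nL κ Φ t p O.merged (gOf κ Φ t p O gv) (fOf κ Φ t p O fv)) (hL κ Φ t p O.merged (gOf κ Φ t p O gv) (fOf κ Φ t p O fv)) + 1 : ℕ)) : ℤ) + (kgZY₀ (nL κ Φ t p O.merged (gOf κ Φ t p O gv) (fOf κ Φ t p O fv)) (vL κ Φ t p O.merged (gOf κ Φ t p O gv) (fOf κ Φ t p O fv)) (kgR κ Φ t p O.merged mk) 0 (kgWY κ Φ t p O.merged (gOf κ Φ t p O gv) (fOf κ Φ t p O fv) WxY) (kgNYv0 κ Φ t p O.merged (gOf κ Φ t p O gv) (fOf κ Φ t p O fv) mk qxY WxY) (kgM₁Y (nL κ Φ t p O.merged (gOf κ Φ t p O gv) (fOf κ Φ t p O fv)) (vL κ Φ t p O.merged (gOf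 κ Φ t p O gv) (fOf κ Φ t p O fv)) (kgR κ Φ t p O.merged mk) 0 (kgWY κ Φ t p O.merged (gOf κ Φ t p O gv) (fOf κ Φ t p O fv) WxY) (kgNYv0 κ Φ t p O.merged (gOf κ Φ t p O gv) (fOf κ Φ t p O fv) mk qxY WxY)) (kgWm₂Y (nL κ Φ t p O.merged (gOf κ Φ t p O gv) (fOf κ Φ t p O fv)) (vL κ Φ t p O.merged (gOf κ Φ t p O gv) (fOf κ Φ t p O fv)) (kgR κ Φ t p O.merged mk) 0 (kgWY κ Φ t p O.merged (gOf κ Φ t p O gv) (fOf κ Φ t p O fv) WxY) (kgNYv0 κ Φ t p O.merged (gOf κ Φ t p O gv) (fOf κ Φ t p O fv) mk qxY WxY)) (kgWp₂Y (nL κ Φ t p O.merged (gOf κ Φ t p O gv) (fOf κ Φ t p O fv)) (vL κ Φ t p O.merged (gOf κ Φ t p O gv) (fOf κ Φ t p O fv)) (kgR κ Φ t p O.merged mk) 0 (kgWY κ Φ t p O.merged (gOf κ Φ t p O gv) (fOf κ Φ t p O fv) WxY) (kgNYv0 κ Φ t p O.merged (gOf κ Φ t p O gv) (fOf κ Φ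 t p O fv) mk qxY WxY)) (kgM₂Y (nL κ Φ t p O.merged (gOf κ Φ t p O gv) (fOf κ Φ t p O fv)) (ℓL κ Φ t p O.merged (gOf κ Φ t p O gv) (fOf κ Φ t p O fv)) (hL κ Φ t p O.merged (gOf κ Φ t p O gv) (fOf κ Φ t p O fv)) (vL κ Φ t p O.merged (gOf κ Φ t p O gv) (fOf κ Φ t p O fv)) (kgR κ Φ t p O.merged mk) 0 (kgqY κ Φ t p O.merged (gOf κ Φ t p O gv) (fOf κ Φ t p O fv) qxY) (kgWY κ Φ t p O.merged (gOf κ Φ t p O gv) (fOf κ Φ t p O fv) WxY) (kgNYv0 κ Φ t p O.merged (gOf κ Φ t p O gv) (fOf κ Φ t p O fv) mk qxY WxY))) + (kgZY₁ (nL κ Φ t p O.merged (gOf κ Φ t p O gv) (fOf κ Φ t p O fv)) (ℓL κ Φ t p O.merged (gOf κ Φ t p O gv) (fOf κ Φ t p O fv)) (hL κ Φ t p O.merged (gOf κ Φ t p O gv) (fOf κ Φ t p O fv)) (kgR κ Φ t p O.merged mk) 0 (kgqY κ Φ t p O.merged (gOf κ Φ t p O gv) (fOf κ Φ t p O fv)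 qxY) (kgNYv0 κ Φ t p O.merged (gOf κ Φ t p O gv) (fOf κ Φ t p O fv) mk qxY WxY) (kgM₁Y (nL κ Φ t p O.merged (gOf κ Φ t p O gv) (fOf κ Φ t p O fv)) (vL κ Φ t p O.merged (gOf κ Φ t p O gv) (fOf κ Φ t p O fv)) (kgR κ Φ t p O.merged mk) 0 (kgWY κ Φ t p O.merged (gOf κ Φ t p O gv) (fOf κ Φ t p O fv) WxY) (kgNYv0 κ Φ t p O.merged (gOf κ Φ t p O gv) (fOf κ Φ t p O fv) mk qxY WxY)) (kgM₂Y (nL κ Φ t p O.merged (gOf κ Φ t p O gv) (fOf κ Φ t p O fv)) (ℓL κ Φ t p O.merged (gOf κ Φ t p O gv) (fOf κ Φ t p O fv)) (hL κ Φ t p O.merged (gOf κ Φ t p O gv) (fOf κ Φ t p O fv)) (vL κ Φ t p O.merged (gOf κ Φ t p O gv) (fOf κ Φ t p O fv)) (kgR κ Φ t p O.merged mk) 0 (kgqY κ Φ t p O.merged (gOf κ Φ t p O gv) (fOf κ Φ t p O fv) qxY) (kgWY κ Φ t p O.merged (gOf κ Φ t p O gv) (fOf κ Φ t p O fv) WxY)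 (kgNYv0 κ Φ t p O.merged (gOf κ Φ t p O gv) (fOf κ Φ t p O fv) mk qxY WxY)))) ≤ (ZY : ℤ))
    -- the cells' radii against the seed
    (hRs5 : ∀ i, KS.Rs t O.merged mk + 1 ≤ 5 * ((fcellsA κ Φ t p O.merged (gOf κ Φ t p O gv) (fOf κ Φ t p O fv))).r i)
    -- the five READING rows of the root's boxes (second axis): bridge region, prefix regions, y′-corridor regions, y′ last core, planar diameter
    (hfoot₁ : ∀ w ∈ graphBall G t (Rπ κ Φ t p O.merged (gOf κ Φ t p O gv) (fOf κ Φ t p O fv) (SUS ex mx) q), rootFrame (φL κ Φ t p O.D O.DT.toDataN O.ori (gOf κ Φ t p O gv) (fOf κ Φ t p O fv)) t 1 w ∈ Finset.Icc (KS.B0 κ Φ t p O.merged mk (gOf κ Φ t p O gv) (fOf κ Φ t p O fv)).regionLo (KS.B0 κ Φ t p O.merged mk (gOf κ Φ t p O gv) (fOf κ Φ t p O fv)).regionHi →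
      RootFootV (fcellsV κ Φ t p O.merged (gOf κ Φ t p O gv) (fOf κ Φ t p O fv) (cOf κ Φ t p O gv fv cv) (hOf κ Φ t p O gv fv hv)) (((1 : Fin 2), true) : MDir) ((fineOA κ Φ t p O.D O.DT.toDataN O.ori (gOf κ Φ t p O gv) (fOf κ Φ t p O fv)) w))
    (hfoot₂ : ∀ c₁ : V, (φL κ Φ t p O.D O.DT.toDataN O.ori (gOf κ Φ t p O gv) (fOf κ Φ t p O fv)) c₁ 0 - (φL κ Φ t p O.D O.DT.toDataN O.ori (gOf κ Φ t p O gv) (fOf κ Φ t p O fv)) t 0 = (KS.X1 κ Φ t p O.merged mk (gOf κ Φ t p O gv) (fOf κ Φ t p O fv) (kgq κ Φ t p O.merged (gOf κ Φ t p O gv) (fOf κ Φ t p O fv) 0)) → (φL κ Φ t p O.D O.DT.toDataN O.ori (gOf κ Φ t p O gv) (fOf κ Φ t p O fv)) c₁ 1 - (φL κ Φ t p O.D O.DT.toDataN O.ori (gOf κ Φ t p O gv) (fOf κ Φ t p O fv)) t 1 = (KS.Y1s κ Φ t p O.merged mk (gOf κ Φ t p O gv) (fOf κ Φ t p O fv)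 (kgq κ Φ t p O.merged (gOf κ Φ t p O gv) (fOf κ Φ t p O fv) 0)) →
      ∀ k ≤ (Skelφ.kgCorrSched ((kgRows0_of κ Φ t p O.merged (gOf κ Φ t p O gv) (fOf κ Φ t p O fv) mk 0 0 (eqNumL_of_atQ (atQ3_of_atQ3V hAt)) hgK).kgVals_ok₁ 30) ((kgRows0_of κ Φ t p O.merged (gOf κ Φ t p O gv) (fOf κ Φ t p O fv) mk 0 0 (eqNumL_of_atQ (atQ3_of_atQ3V hAt)) hgK).kgVals_ok₂ 30) ((kgRows0_of κ Φ t p O.merged (gOf κ Φ t p O gv) (fOf κ Φ t p O fv) mk 0 0 (eqNumL_of_atQ (atQ3_of_atQ3V hAt)) hgK).kgVals_split 30)).N, ∀ w ∈ graphBall G t (Rπ κ Φ t p O.merged (gOf κ Φ t p O gv) (fOf κ Φ t p O fv) (SUS ex mx) q), Skelφ.runX (φL κ Φ t p O.D O.DT.toDataN O.ori (gOf κ Φ t p O gv) (fOf κ Φ t p O fv)) c₁ (nL κ Φ t p O.merged (gOf κ Φ t p O gv) (fOf κ Φ t p O fv)) (hL κ Φ t p O.merged (gOf κ Φ t p O gv)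 (fOf κ Φ t p O fv)) 1 w ∈ (Skelφ.kgCorrSched ((kgRows0_of κ Φ t p O.merged (gOf κ Φ t p O gv) (fOf κ Φ t p O fv) mk 0 0 (eqNumL_of_atQ (atQ3_of_atQ3V hAt)) hgK).kgVals_ok₁ 30) ((kgRows0_of κ Φ t p O.merged (gOf κ Φ t p O gv) (fOf κ Φ t p O fv) mk 0 0 (eqNumL_of_atQ (atQ3_of_atQ3V hAt)) hgK).kgVals_ok₂ 30) ((kgRows0_of κ Φ t p O.merged (gOf κ Φ t p O gv) (fOf κ Φ t p O fv) mk 0 0 (eqNumL_of_atQ (atQ3_of_atQ3V hAt)) hgK).kgVals_split 30)).region k →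
        RootFootV (fcellsV κ Φ t p O.merged (gOf κ Φ t p O gv) (fOf κ Φ t p O fv) (cOf κ Φ t p O gv fv cv) (hOf κ Φ t p O gv fv hv)) (((1 : Fin 2), true) : MDir) ((fineOA κ Φ t p O.D O.DT.toDataN O.ori (gOf κ Φ t p O gv) (fOf κ Φ t p O fv)) w))
    (hfoot₃ : ∀ c₂ : V, (φL κ Φ t p O.D O.DT.toDataN O.ori (gOf κ Φ t p O gv) (fOf κ Φ t p O fv)) c₂ 0 - (φL κ Φ t p O.D O.DT.toDataN O.ori (gOf κ Φ t p O gv) (fOf κ Φ t p O fv)) t 0 = (((KS.X2R κ Φ t p O.merged mk (gOf κ Φ t p O gv) (fOf κ Φ t p O fv) WxY) : ℕ) : ℤ) → (φL κ Φ t p O.D O.DT.toDataN O.ori (gOf κ Φ t p O gv) (fOf κ Φ t p O fv)) c₂ 1 - (φL κ Φ t p O.D O.DT.toDataN O.ori (gOf κ Φ t p O gv) (fOf κ Φ t p O fv)) t 1 = (KS.Y2R κ Φ t p O.merged mk (gOf κ Φ t p O gv) (fOf κ Φ t p O fv) WxY) →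
      ∀ k ≤ (Skelφ.kgCorrSchedY (kgYRows0_of κ Φ t p O.merged (gOf κ Φ t p O gv) (fOf κ Φ t p O fv) mk qxY (KS.WxYR κ Φ t p O.merged mk (gOf κ Φ t p O gv) (fOf κ Φ t p O fv) WxY) (eqNumL_of_atQ (atQ3_of_atQ3V hAt)) hgK).hn (kgYRows0_of κ Φ t p O.merged (gOf κ Φ t p O gv) (fOf κ Φ t p O fv) mk qxY (KS.WxYR κ Φ t p O.merged mk (gOf κ Φ t p O gv) (fOf κ Φ t p O fv) WxY) (eqNumL_of_atQ (atQ3_of_atQ3V hAt)) hgK).hv (kgYRows0_of κ Φ t p O.merged (gOf κ Φ t p O gv) (fOf κ Φ t p O fv) mk qxY (KS.WxYR κ Φ t p O.merged mk (gOf κ Φ t p O gv) (fOf κ Φ t p O fv) WxY) (eqNumL_of_atQ (atQ3_of_atQ3V hAt)) hgK).hlay ((kgYRows0_of κ Φ t p O.merged (gOf κ Φ t p O gv) (fOf κ Φ t p O fv) mk qxY (KS.WxYR κ Φ t p O.merged mk (gOf κ Φ t p O gv) (fOf κ Φ t p O fv) WxY) (eqNumL_of_atQ (atQ3_of_atQ3V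 hAt)) hgK).kgYVals_ok₁ (kgNYv0 κ Φ t p O.merged (gOf κ Φ t p O gv) (fOf κ Φ t p O fv) mk qxY WxY)) ((kgYRows0_of κ Φ t p O.merged (gOf κ Φ t p O gv) (fOf κ Φ t p O fv) mk qxY (KS.WxYR κ Φ t p O.merged mk (gOf κ Φ t p O gv) (fOf κ Φ t p O fv) WxY) (eqNumL_of_atQ (atQ3_of_atQ3V hAt)) hgK).kgYVals_ok₂ (kgNYv0 κ Φ t p O.merged (gOf κ Φ t p O gv) (fOf κ Φ t p O fv) mk qxY WxY)) ((kgYRows0_of κ Φ t p O.merged (gOf κ Φ t p O gv) (fOf κ Φ t p O fv) mk qxY (KS.WxYR κ Φ t p O.merged mk (gOf κ Φ t p O gv) (fOf κ Φ t p O fv) WxY) (eqNumL_of_atQ (atQ3_of_atQ3V hAt)) hgK).kgYVals_split (kgNYv0 κ Φ t p O.merged (gOf κ Φ t p O gv) (fOf κ Φ t p O fv) mk qxY WxY))).N, ∀ w ∈ graphBall G t (Rπ κ Φ t p O.merged (gOf κ Φ t p O gv) (fOf κ Φ t p O fv) (SUS ex mx) q), Skelφ.runX (φL κ Φ t p O.D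 O.DT.toDataN O.ori (gOf κ Φ t p O gv) (fOf κ Φ t p O fv)) c₂ (nL κ Φ t p O.merged (gOf κ Φ t p O gv) (fOf κ Φ t p O fv)) (hL κ Φ t p O.merged (gOf κ Φ t p O gv) (fOf κ Φ t p O fv)) 1 w ∈ (Skelφ.kgCorrSchedY (kgYRows0_of κ Φ t p O.merged (gOf κ Φ t p O gv) (fOf κ Φ t p O fv) mk qxY (KS.WxYR κ Φ t p O.merged mk (gOf κ Φ t p O gv) (fOf κ Φ t p O fv) WxY) (eqNumL_of_atQ (atQ3_of_atQ3V hAt)) hgK).hn (kgYRows0_of κ Φ t p O.merged (gOf κ Φ t p O gv) (fOf κ Φ t p O fv) mk qxY (KS.WxYR κ Φ t p O.merged mk (gOf κ Φ t p O gv) (fOf κ Φ t p O fv) WxY) (eqNumL_of_atQ (atQ3_of_atQ3V hAt)) hgK).hv (kgYRows0_of κ Φ t p O.merged (gOf κ Φ t p O gv) (fOf κ Φ t p O fv) mk qxY (KS.WxYR κ Φ t p O.merged mk (gOf κ Φ t p O gv) (fOf κ Φ t p O fv) WxY) (eqNumL_of_atQ (atQ3_of_atQ3V hAt)) hgK).hlay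 ((kgYRows0_of κ Φ t p O.merged (gOf κ Φ t p O gv) (fOf κ Φ t p O fv) mk qxY (KS.WxYR κ Φ t p O.merged mk (gOf κ Φ t p O gv) (fOf κ Φ t p O fv) WxY) (eqNumL_of_atQ (atQ3_of_atQ3V hAt)) hgK).kgYVals_ok₁ (kgNYv0 κ Φ t p O.merged (gOf κ Φ t p O gv) (fOf κ Φ t p O fv) mk qxY WxY)) ((kgYRows0_of κ Φ t p O.merged (gOf κ Φ t p O gv) (fOf κ Φ t p O fv) mk qxY (KS.WxYR κ Φ t p O.merged mk (gOf κ Φ t p O gv) (fOf κ Φ t p O fv) WxY) (eqNumL_of_atQ (atQ3_of_atQ3V hAt)) hgK).kgYVals_ok₂ (kgNYv0 κ Φ t p O.merged (gOf κ Φ t p O gv) (fOf κ Φ t p O fv) mk qxY WxY)) ((kgYRows0_of κ Φ t p O.merged (gOf κ Φ t p O gv) (fOf κ Φ t p O fv) mk qxY (KS.WxYR κ Φ t p O.merged mk (gOf κ Φ t p O gv) (fOf κ Φ t p O fv) WxY) (eqNumL_of_atQ (atQ3_of_atQ3V hAt)) hgK).kgYVals_split (kgNYv0 κ Φ t p O.merged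 (gOf κ Φ t p O gv) (fOf κ Φ t p O fv) mk qxY WxY))).region k →
        RootFootV (fcellsV κ Φ t p O.merged (gOf κ Φ t p O gv) (fOf κ Φ t p O fv) (cOf κ Φ t p O gv fv cv) (hOf κ Φ t p O gv fv hv)) (((1 : Fin 2), true) : MDir) ((fineOA κ Φ t p O.D O.DT.toDataN O.ori (gOf κ Φ t p O gv) (fOf κ Φ t p O fv)) w))
    (hlastf : ∀ c₂ : V, (φL κ Φ t p O.D O.DT.toDataN O.ori (gOf κ Φ t p O gv) (fOf κ Φ t p O fv)) c₂ 0 - (φL κ Φ t p O.D O.DT.toDataN O.ori (gOf κ Φ t p O gv) (fOf κ Φ t p O fv)) t 0 = (((KS.X2R κ Φ t p O.merged mk (gOf κ Φ t p O gv) (fOf κ Φ t p O fv) WxY) : ℕ) : ℤ) → (φL κ Φ t p O.D O.DT.toDataN O.ori (gOf κ Φ t p O gv) (fOf κ Φ t p O fv)) c₂ 1 - (φL κ Φ t p O.D O.DT.toDataN O.ori (gOf κ Φ t p O gv) (fOf κ Φ t p O fv)) t 1 = (KS.Y2R κ Φ t p O.merged mk (gOf κ Φ t p O gv) (fOf κ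 Φ t p O fv) WxY) →
      ∀ w ∈ graphBall G t (Rπ κ Φ t p O.merged (gOf κ Φ t p O gv) (fOf κ Φ t p O fv) (SUS ex mx) q), Skelφ.runX (φL κ Φ t p O.D O.DT.toDataN O.ori (gOf κ Φ t p O gv) (fOf κ Φ t p O fv)) c₂ (nL κ Φ t p O.merged (gOf κ Φ t p O gv) (fOf κ Φ t p O fv)) (hL κ Φ t p O.merged (gOf κ Φ t p O gv) (fOf κ Φ t p O fv)) 1 w ∈ ScheduleNP.core (Skelφ.kgCorrSchedY (kgYRows0_of κ Φ t p O.merged (gOf κ Φ t p O gv) (fOf κ Φ t p O fv) mk qxY (KS.WxYR κ Φ t p O.merged mk (gOf κ Φ t p O gv) (fOf κ Φ t p O fv) WxY) (eqNumL_of_atQ (atQ3_of_atQ3V hAt)) hgK).hn (kgYRows0_of κ Φ t p O.merged (gOf κ Φ t p O gv) (fOf κ Φ t p O fv) mk qxY (KS.WxYR κ Φ t p O.merged mk (gOf κ Φ t p O gv) (fOf κ Φ t p O fv) WxY) (eqNumL_of_atQ (atQ3_of_atQ3V hAt)) hgK).hv (kgYRows0_of κ Φ t p O.merged (gOf κ Φ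 t p O gv) (fOf κ Φ t p O fv) mk qxY (KS.WxYR κ Φ t p O.merged mk (gOf κ Φ t p O gv) (fOf κ Φ t p O fv) WxY) (eqNumL_of_atQ (atQ3_of_atQ3V hAt)) hgK).hlay ((kgYRows0_of κ Φ t p O.merged (gOf κ Φ t p O gv) (fOf κ Φ t p O fv) mk qxY (KS.WxYR κ Φ t p O.merged mk (gOf κ Φ t p O gv) (fOf κ Φ t p O fv) WxY) (eqNumL_of_atQ (atQ3_of_atQ3V hAt)) hgK).kgYVals_ok₁ (kgNYv0 κ Φ t p O.merged (gOf κ Φ t p O gv) (fOf κ Φ t p O fv) mk qxY WxY)) ((kgYRows0_of κ Φ t p O.merged (gOf κ Φ t p O gv) (fOf κ Φ t p O fv) mk qxY (KS.WxYR κ Φ t p O.merged mk (gOf κ Φ t p O gv) (fOf κ Φ t p O fv) WxY) (eqNumL_of_atQ (atQ3_of_atQ3V hAt)) hgK).kgYVals_ok₂ (kgNYv0 κ Φ t p O.merged (gOf κ Φ t p O gv) (fOf κ Φ t p O fv) mk qxY WxY)) ((kgYRows0_of κ Φ t p O.merged (gOf κ Φ t p O gv) (fOf κ Φ t p O fv)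 mk qxY (KS.WxYR κ Φ t p O.merged mk (gOf κ Φ t p O gv) (fOf κ Φ t p O fv) WxY) (eqNumL_of_atQ (atQ3_of_atQ3V hAt)) hgK).kgYVals_split (kgNYv0 κ Φ t p O.merged (gOf κ Φ t p O gv) (fOf κ Φ t p O fv) mk qxY WxY))) ((Skelφ.kgCorrSchedY (kgYRows0_of κ Φ t p O.merged (gOf κ Φ t p O gv) (fOf κ Φ t p O fv) mk qxY (KS.WxYR κ Φ t p O.merged mk (gOf κ Φ t p O gv) (fOf κ Φ t p O fv) WxY) (eqNumL_of_atQ (atQ3_of_atQ3V hAt)) hgK).hn (kgYRows0_of κ Φ t p O.merged (gOf κ Φ t p O gv) (fOf κ Φ t p O fv) mk qxY (KS.WxYR κ Φ t p O.merged mk (gOf κ Φ t p O gv) (fOf κ Φ t p O fv) WxY) (eqNumL_of_atQ (atQ3_of_atQ3V hAt)) hgK).hv (kgYRows0_of κ Φ t p O.merged (gOf κ Φ t p O gv) (fOf κ Φ t p O fv) mk qxY (KS.WxYR κ Φ t p O.merged mk (gOf κ Φ t p O gv) (fOf κ Φ t p O fv) WxY) (eqNumL_of_atQ (atQ3_of_atQ3V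 hAt)) hgK).hlay ((kgYRows0_of κ Φ t p O.merged (gOf κ Φ t p O gv) (fOf κ Φ t p O fv) mk qxY (KS.WxYR κ Φ t p O.merged mk (gOf κ Φ t p O gv) (fOf κ Φ t p O fv) WxY) (eqNumL_of_atQ (atQ3_of_atQ3V hAt)) hgK).kgYVals_ok₁ (kgNYv0 κ Φ t p O.merged (gOf κ Φ t p O gv) (fOf κ Φ t p O fv) mk qxY WxY)) ((kgYRows0_of κ Φ t p O.merged (gOf κ Φ t p O gv) (fOf κ Φ t p O fv) mk qxY (KS.WxYR κ Φ t p O.merged mk (gOf κ Φ t p O gv) (fOf κ Φ t p O fv) WxY) (eqNumL_of_atQ (atQ3_of_atQ3V hAt)) hgK).kgYVals_ok₂ (kgNYv0 κ Φ t p O.merged (gOf κ Φ t p O gv) (fOf κ Φ t p O fv) mk qxY WxY)) ((kgYRows0_of κ Φ t p O.merged (gOf κ Φ t p O gv) (fOf κ Φ t p O fv) mk qxY (KS.WxYR κ Φ t p O.merged mk (gOf κ Φ t p O gv) (fOf κ Φ t p O fv) WxY) (eqNumL_of_atQ (atQ3_of_atQ3V hAt)) hgK).kgYVals_split (kgNYv0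 κ Φ t p O.merged (gOf κ Φ t p O gv) (fOf κ Φ t p O fv) mk qxY WxY))).N + 1) →
        TargetFootV (fcellsV κ Φ t p O.merged (gOf κ Φ t p O gv) (fOf κ Φ t p O fv) (cOf κ Φ t p O gv fv cv) (hOf κ Φ t p O gv fv hv)) (bOf κ Φ t p O gv fv bv) (((1 : Fin 2), true) : MDir) ((fineOA κ Φ t p O.D O.DT.toDataN O.ori (gOf κ Φ t p O gv) (fOf κ Φ t p O fv)) w))
    (hDm : ∀ d ∈ ((((KSchA.mk (ΓQV κ Φ t p O gv fv (SUS ex mx) cv hv bv q) q κ.δ : KSchA V ℕ)).U0root (((1 : Fin 2), true) : MDir)).filter fun y => y ∈ graphBall G t (Rπ κ Φ t p O.merged (gOf κ Φ t p O gv) (fOf κ Φ t p O fv) (SUS ex mx) q)) \ O.merged.Λ t O.merged.k,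
      ∀ d' ∈ ((((KSchA.mk (ΓQV κ Φ t p O gv fv (SUS ex mx) cv hv bv q) q κ.δ : KSchA V ℕ)).U0root (((1 : Fin 2), true) : MDir)).filter fun y => y ∈ graphBall G t (Rπ κ Φ t p O.merged (gOf κ Φ t p O gv) (fOf κ Φ t p O fv) (SUS ex mx) q)) \ O.merged.Λ t O.merged.k,
        (φL κ Φ t p O.D O.DT.toDataN O.ori (gOf κ Φ t p O gv) (fOf κ Φ t p O fv)) d - (φL κ Φ t p O.D O.DT.toDataN O.ori (gOf κ Φ t p O gv) (fOf κ Φ t p O fv)) d' ∈ box 2 (mRS κ Φ t p O.merged (gOf κ Φ t p O gv) (fOf κ Φ t p O fv) (mx κ Φ t p O.merged (gOf κ Φ t p O gv) (fOf κ Φ t p O fv)))) :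
    ∃ n, n ≤ LfQ κ.K₀ ∧ ∃ (c : V) (Rπ : ℕ) (W : Sym2 V → unitInterval) (s : Fin (n + 1) → KNLevels.TStep (winGraph G c Rπ))
      (T' : Fin (n + 1) → Finset V) (η' : ℝ),
      (∀ T : Finset V, (prodBernoulli W).real (⋃ t' ∈ T, openConn (ΓQV κ Φ t p O gv fv (SUS ex mx) cv hv bv q).root t') ≤
        (prodBernoulli (pinW (KNLevels.lattW G q) ↑((⟨ΓQV κ Φ t p O gv fv (SUS ex mx) cv hv bv q, q, κ.δ⟩ : KSchA V ℕ).U₀ G)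
          ↑((⟨ΓQV κ Φ t p O gv fv (SUS ex mx) cv hv bv q, q, κ.δ⟩ : KSchA V ℕ).U₀ G))).real
          (⋃ t' ∈ (↑T : Set V), openConnIn (↑((ΓQV κ Φ t p O gv fv (SUS ex mx) cv hv bv q).Q (ΓQV κ Φ t p O gv fv (SUS ex mx) cv hv bv q).a₀ 0 ∪
            (ΓQV κ Φ t p O gv fv (SUS ex mx) cv hv bv q).Ewv (ΓQV κ Φ t p O gv fv (SUS ex mx) cv hv bv q).a₀ 0 (((1 : Fin 2), true) : MDir)) : Set V)
            (ΓQV κ Φ t p O gv fv (SUS ex mx) cv hv bv q).root t')) ∧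
      (∀ i : Fin (n + 1), (s i).L.o = (ΓQV κ Φ t p O gv fv (SUS ex mx) cv hv bv q).root) ∧
      (∀ i : Fin n, T' (Fin.castSucc i) ⊆ (s i.succ).L.X 0) ∧ (∀ i : Fin (n + 1), T' i ⊆ (s i).T) ∧
      (∀ i : Fin (n + 1), (s i).KitsAtF W q Φ.Δ (κ.δr 0)) ∧ η' ≤ κ.δr 0 / 2 ∧
      (∀ i : Fin (n + 1), (prodBernoulli W).real (⋃ t' ∈ (s i).T \ T' i, openConn (ΓQV κ Φ t p O gv fv (SUS ex mx) cv hv bv q).root t') ≤ η') ∧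
      1 - κ.δr 0 < (prodBernoulli W).real (s 0).L.reachB ∧
      T' (Fin.last n) ⊆ (ΓQV κ Φ t p O gv fv (SUS ex mx) cv hv bv q).M (ΓQV κ Φ t p O gv fv (SUS ex mx) cv hv bv q).a₀ ((0 : Site 2) + stepVec (((1 : Fin 2), true) : MDir)) := by
  have hAt' := atQ3_of_atQ3V hAt
  -- facts at `AtQNQ`
  have hN : EqNumL κ Φ t p O.merged (gOf κ Φ t p O gv) (fOf κ Φ t p O fv) := eqNumL_of_atQ hAt'
  obtain ⟨hn1, -⟩ := one_le_of_eqNumL κ Φ t p O.merged (gOf κ Φ t p O gv) (fOf κ Φ t p O fv) hN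
  obtain ⟨-, -, -, hCq⟩ := factsNS_of_atQ hAt'
  have hkit : Neg.δkit κ Φ ≤ κ.δr 0 := Neg.δkit_le_δr κ Φ (n := 0) (by norm_num)
  have hη : Neg.η κ Φ ≤ κ.δr 0 / 2 := by
    unfold Neg.η; exact div_le_div_of_nonneg_right hkit (by norm_num)
  have hstepφ := steps_φL κ Φ t p O.D O.DT.toDataN O.ori (gOf κ Φ t p O gv) (fOf κ Φ t p O fv)
  obtain ⟨-, -, hs958, -, -, -, -⟩ := KS.rootRun_floors κ Φ t p O.merged mk (gOf κ Φ t p O gv) (fOf κ Φ t p O fv) hN hgK hg2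
  have hsL0 : (0 : ℤ) ≤ (kgSL (nL κ Φ t p O.merged (gOf κ Φ t p O gv) (fOf κ Φ t p O fv)) (ℓL κ Φ t p O.merged (gOf κ Φ t p O gv) (fOf κ Φ t p O fv)) (hL κ Φ t p O.merged (gOf κ Φ t p O gv) (fOf κ Φ t p O fv))) := by linarith
  obtain ⟨hnR, hrow⟩ := KS.hrowP κ Φ t p O.merged mk (gOf κ Φ t p O gv) (fOf κ Φ t p O fv) hN hgK hg2
  -- the two landing vertices on the terminal's shear line ((R-47)(a), (R-46)(a))
  obtain ⟨c₁, hc₁, hX1, hY1⟩ := KS.exists_landing0s κ Φ t p O.merged mk (gOf κ Φ t p O gv) (fOf κ Φ t p O fv) (kgq κ Φ t p O.merged (gOf κ Φ t p O gv) (fOf κ Φ t p O fv) 0) hstepφ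
  obtain ⟨c₂, hc₂, hX2, hY2⟩ := KS.exists_landing2 κ Φ t p O.merged mk (gOf κ Φ t p O gv) (fOf κ Φ t p O fv) WxY hstepφ
  -- the bridge of record
  have hℓB27 := ℓB0_ge_of_atQ3 hAt' mk
  have hℓB3 : 3 ≤ KS.ℓB0 κ Φ t p O.merged mk := by omega
  obtain ⟨hQb, hFb, -⟩ := bridge0Sets_of_atQ3 hAt' mk
  have hbridge := hbridge0K_of_atQ3_δr hAt' h1 mk hPx
  -- the ex-floors read into the window radius `Rπ`
  have hr₀R := ex_le_Rπ κ Φ t p O.merged (gOf κ Φ t p O gv) (fOf κ Φ t p O fv) ex mx q hexRL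
  have hr₀bR := ex_le_Rπ κ Φ t p O.merged (gOf κ Φ t p O gv) (fOf κ Φ t p O fv) ex mx q hexRB
  have hYbπ := ex_le_Rπ κ Φ t p O.merged (gOf κ Φ t p O gv) (fOf κ Φ t p O fv) ex mx q hexYb
  have hPπ := ex_le_Rπ κ Φ t p O.merged (gOf κ Φ t p O gv) (fOf κ Φ t p O fv) ex mx q hexP
  have hYπ := ex_le_Rπ κ Φ t p O.merged (gOf κ Φ t p O gv) (fOf κ Φ t p O fv) ex mx q hexY
  have hc1R : ((KS.B0 κ Φ t p O.merged mk (gOf κ Φ t p O gv) (fOf κ Φ t p O fv)).core1Lo 0).natAbs + ((KS.B0 κ Φ t p O.merged mk (gOf κ Φ t p O gv) (fOf κ Φ t p O fv)).core1Lo 1).natAbs ≤ (Rπ κ Φ t p O.merged (gOf κ Φ t p O gv) (fOf κ Φ t p O fv) (SUS ex mx) q) :=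
    (KS.core1Lo_0_l1 κ Φ t p O.merged mk (gOf κ Φ t p O gv) (fOf κ Φ t p O fv)).trans hYbπ
  -- the cross-link budget of the PREFIX `prB0 + ℓB0 + 5R'0 + 2 ≤ kgW 0 = ⌊sL⌋` ((R-47)(b) amended: `sL ≥ M_L − 1 ≥ g − 1 ≥ 2f + 5R'0 + 2`)
  have hprB := KS.le_prB0 κ Φ t p O.merged mk
  have hfx : KS.Rs t O.merged mk + KS0.R'0 κ Φ t p O.merged mk + KS.prB0 κ Φ t p O.merged mk + 1 ≤ fOf κ Φ t p O fv := by
    have h := hf; rw [KS.fxR0_eq] at h; exact h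
  have hML := (ML_le_ML κ Φ t p O.merged (gOf κ Φ t p O gv)).2
  have hsL := ML_sub_one_le_kgSL κ Φ t p O.merged (gOf κ Φ t p O gv) (fOf κ Φ t p O fv) hN
  have hW : ((KS.prB0 κ Φ t p O.merged mk : ℕ) : ℤ) + (KS.ℓB0 κ Φ t p O.merged mk) + 5 * (KS0.R'0 κ Φ t p O.merged mk : ℤ) + 2 ≤ (kgW κ Φ t p O.merged (gOf κ Φ t p O gv) (fOf κ Φ t p O fv) 0 : ℕ) := by
    have h1 : ((ML κ Φ t p O.merged (gOf κ Φ t p O gv) : ℕ) : ℤ) - 1 ≤ (kgW κ Φ t p O.merged (gOf κ Φ t p O gv) (fOf κ Φ t p O fv) 0 : ℕ) := by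
      unfold kgW; push_cast; rw [Int.toNat_of_nonneg hsL0]; linarith
    have h2 : ((gOf κ Φ t p O gv : ℕ) : ℤ) ≤ ((ML κ Φ t p O.merged (gOf κ Φ t p O gv) : ℕ) : ℤ) := by exact_mod_cast hML
    have h3 : 2 * ((fOf κ Φ t p O fv : ℕ) : ℤ) + 5 * (KS0.R'0 κ Φ t p O.merged mk : ℤ) + 3 ≤ ((gOf κ Φ t p O gv : ℕ) : ℤ) := by exact_mod_cast hfg
    have h4n : KS.prB0 κ Φ t p O.merged mk + 1 ≤ fOf κ Φ t p O fv := by have := hfx; omega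
    have h4 : ((KS.prB0 κ Φ t p O.merged mk : ℕ) : ℤ) + 1 ≤ ((fOf κ Φ t p O fv : ℕ) : ℤ) := by exact_mod_cast h4n
    have h5n : 3 * KS.ℓB0 κ Φ t p O.merged mk ≤ KS.prB0 κ Φ t p O.merged mk := by have := hprB.2; omega
    have h5 : 3 * ((KS.ℓB0 κ Φ t p O.merged mk : ℕ) : ℤ) ≤ ((KS.prB0 κ Φ t p O.merged mk : ℕ) : ℤ) := by exact_mod_cast h5n
    linarith
  have hRq : KS0.R'0 κ Φ t p O.merged mk ≤ kgq κ Φ t p O.merged (gOf κ Φ t p O gv) (fOf κ Φ t p O fv) 0 := by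
    unfold kgq; omega
  -- the PREFIX depth row: `D0s(2n_L) + 13·reach(prefix) ≤ D0s + ZDP ≤ Rπ`
  have hreachP := KS.reachP_le κ Φ t p O.merged mk (gOf κ Φ t p O gv) (fOf κ Φ t p O fv) hN hgK hg2
  have hRD : ((KS.D0s κ Φ t p O.merged mk (gOf κ Φ t p O gv) (fOf κ Φ t p O fv) (kgq κ Φ t p O.merged (gOf κ Φ t p O gv) (fOf κ Φ t p O fv) 0) : ℕ) : ℤ) +
      (10 + 3) * ((((30 : ℕ) : ℤ) + 1) * ((nL κ Φ t p O.merged (gOf κ Φ t p O gv) (fOf κ Φ t p O fv)) : ℤ) +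
        kgZ₀ (nL κ Φ t p O.merged (gOf κ Φ t p O gv) (fOf κ Φ t p O fv)) (vL κ Φ t p O.merged (gOf κ Φ t p O gv) (fOf κ Φ t p O fv)) (KS0.R'0 κ Φ t p O.merged mk) 0 (kgq κ Φ t p O.merged (gOf κ Φ t p O gv) (fOf κ Φ t p O fv) 0) 30
          (kgM₁ (nL κ Φ t p O.merged (gOf κ Φ t p O gv) (fOf κ Φ t p O fv)) (ℓL κ Φ t p O.merged (gOf κ Φ t p O gv) (fOf κ Φ t p O fv)) (hL κ Φ t p O.merged (gOf κ Φ t p O gv) (fOf κ Φ t p O fv)) (KS0.R'0 κ Φ t p O.merged mk) 0 (kgW κ Φ t p O.merged (gOf κ Φ t p O gv) (fOf κ Φ t p O fv) 0) 30)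
          (kgM₂ (nL κ Φ t p O.merged (gOf κ Φ t p O gv) (fOf κ Φ t p O fv)) (ℓL κ Φ t p O.merged (gOf κ Φ t p O gv) (fOf κ Φ t p O fv)) (hL κ Φ t p O.merged (gOf κ Φ t p O gv) (fOf κ Φ t p O fv)) (vL κ Φ t p O.merged (gOf κ Φ t p O gv) (fOf κ Φ t p O fv)) (KS0.R'0 κ Φ t p O.merged mk) 0 (kgq κ Φ t p O.merged (gOf κ Φ t p O gv) (fOf κ Φ t p O fv) 0) (kgW κ Φ t p O.merged (gOf κ Φ t p O gv) (fOf κ Φ t p O fv) 0) 30) +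
        kgZ₁ (nL κ Φ t p O.merged (gOf κ Φ t p O gv) (fOf κ Φ t p O fv)) (ℓL κ Φ t p O.merged (gOf κ Φ t p O gv) (fOf κ Φ t p O fv)) (hL κ Φ t p O.merged (gOf κ Φ t p O gv) (fOf κ Φ t p O fv)) (KS0.R'0 κ Φ t p O.merged mk) 0 (kgW κ Φ t p O.merged (gOf κ Φ t p O gv) (fOf κ Φ t p O fv) 0) 30
          (kgM₁ (nL κ Φ t p O.merged (gOf κ Φ t p O gv) (fOf κ Φ t p O fv)) (ℓL κ Φ t p O.merged (gOf κ Φ t p O gv) (fOf κ Φ t p O fv)) (hL κ Φ t p O.merged (gOf κ Φ t p O gv) (fOf κ Φ t p O fv)) (KS0.R'0 κ Φ t p O.merged mk) 0 (kgW κ Φ t p O.merged (gOf κ Φ t p O gv) (fOf κ Φ t p O fv) 0) 30)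
          (kgWm₂ (nL κ Φ t p O.merged (gOf κ Φ t p O gv) (fOf κ Φ t p O fv)) (ℓL κ Φ t p O.merged (gOf κ Φ t p O gv) (fOf κ Φ t p O fv)) (hL κ Φ t p O.merged (gOf κ Φ t p O gv) (fOf κ Φ t p O fv)) (KS0.R'0 κ Φ t p O.merged mk) 0 (kgW κ Φ t p O.merged (gOf κ Φ t p O gv) (fOf κ Φ t p O fv) 0) 30)
          (kgWp₂ (nL κ Φ t p O.merged (gOf κ Φ t p O gv) (fOf κ Φ t p O fv)) (ℓL κ Φ t p O.merged (gOf κ Φ t p O gv) (fOf κ Φ t p O fv)) (hL κ Φ t p O.merged (gOf κ Φ t p O gv) (fOf κ Φ t p O fv)) (KS0.R'0 κ Φ t p O.merged mk) 0 (kgW κ Φ t p O.merged (gOf κ Φ t p O gv) (fOf κ Φ t p O fv) 0) 30)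
          (kgM₂ (nL κ Φ t p O.merged (gOf κ Φ t p O gv) (fOf κ Φ t p O fv)) (ℓL κ Φ t p O.merged (gOf κ Φ t p O gv) (fOf κ Φ t p O fv)) (hL κ Φ t p O.merged (gOf κ Φ t p O gv) (fOf κ Φ t p O fv)) (vL κ Φ t p O.merged (gOf κ Φ t p O gv) (fOf κ Φ t p O fv)) (KS0.R'0 κ Φ t p O.merged mk) 0 (kgq κ Φ t p O.merged (gOf κ Φ t p O gv) (fOf κ Φ t p O fv) 0) (kgW κ Φ t p O.merged (gOf κ Φ t p O gv) (fOf κ Φ t p O fv) 0) 30)) ≤ (Rπ κ Φ t p O.merged (gOf κ Φ t p O gv) (fOf κ Φ t p O fv) (SUS ex mx) q) := by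
    have h1 : ((KS.D0s κ Φ t p O.merged mk (gOf κ Φ t p O gv) (fOf κ Φ t p O fv) (kgq κ Φ t p O.merged (gOf κ Φ t p O gv) (fOf κ Φ t p O fv) 0) : ℕ) : ℤ) + (KS.ZDP κ Φ t p O.merged (gOf κ Φ t p O gv) (fOf κ Φ t p O fv) : ℤ) ≤ (Rπ κ Φ t p O.merged (gOf κ Φ t p O gv) (fOf κ Φ t p O fv) (SUS ex mx) q) := by
      exact_mod_cast hPπ
    have e : ((10 : ℤ) + 3) = 13 := by norm_num
    rw [e]
    unfold kgR at hreachP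
    push_cast at hreachP ⊢
    linarith
  -- the y′-corridor depth row: `D2R + 13·reach(y′, reduced window) ≤ D2R + ZY + 13·n_L ≤ Rπ`
  have hreachY := KS.reachRY_le κ Φ t p O.merged mk (gOf κ Φ t p O gv) (fOf κ Φ t p O fv) qxY WxY hN hgK (ZY : ℤ) hZY
  have hRD₃ : ((KS.D2R κ Φ t p O.merged mk (gOf κ Φ t p O gv) (fOf κ Φ t p O fv) WxY : ℕ) : ℤ) + (10 + 3) * ((((((kgNYv0 κ Φ t p O.merged (gOf κ Φ t p O gv) (fOf κ Φ t p O fv) mk qxY WxY) : ℕ)) : ℤ) + 1) * ((((nL κ Φ t p O.merged (gOf κ Φ t p O gv) (fOf κ Φ t p O fv)) * (ℓL κ Φ t p O.merged (gOf κ Φ t p O gv) (fOf κ Φ t p O fv)) / Skelφ.shearUnit (nL κ Φ t p O.merged (gOf κ Φ t p O gv) (fOf κ Φ t p O fv)) (hL κ Φ t p O.merged (gOf κ Φ t p O gv) (fOf κ Φ t p O fv)) + 1 : ℕ)) : ℤ) + (kgZY₀ (nL κ Φ t p O.merged (gOf κ Φ t p O gv) (fOf κ Φ t p O fv)) (vL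 κ Φ t p O.merged (gOf κ Φ t p O gv) (fOf κ Φ t p O fv)) (KS0.R'0 κ Φ t p O.merged mk) 0 (kgWY κ Φ t p O.merged (gOf κ Φ t p O gv) (fOf κ Φ t p O fv) (KS.WxYR κ Φ t p O.merged mk (gOf κ Φ t p O gv) (fOf κ Φ t p O fv) WxY)) (kgNYv0 κ Φ t p O.merged (gOf κ Φ t p O gv) (fOf κ Φ t p O fv) mk qxY WxY) (kgM₁Y (nL κ Φ t p O.merged (gOf κ Φ t p O gv) (fOf κ Φ t p O fv)) (vL κ Φ t p O.merged (gOf κ Φ t p O gv) (fOf κ Φ t p O fv)) (KS0.R'0 κ Φ t p O.merged mk) 0 (kgWY κ Φ t p O.merged (gOf κ Φ t p O gv) (fOf κ Φ t p O fv) (KS.WxYR κ Φ t p O.merged mk (gOf κ Φ t p O gv) (fOf κ Φ t p O fv) WxY)) (kgNYv0 κ Φ t p O.merged (gOf κ Φ t p O gv) (fOf κ Φ t p O fv) mk qxY WxY)) (kgWm₂Y (nL κ Φ t p O.merged (gOf κ Φ t p O gv) (fOf κ Φ t p O fv)) (vL κ Φ t p O.merged (gOf κ Φ t p O gv) (fOf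 κ Φ t p O fv)) (KS0.R'0 κ Φ t p O.merged mk) 0 (kgWY κ Φ t p O.merged (gOf κ Φ t p O gv) (fOf κ Φ t p O fv) (KS.WxYR κ Φ t p O.merged mk (gOf κ Φ t p O gv) (fOf κ Φ t p O fv) WxY)) (kgNYv0 κ Φ t p O.merged (gOf κ Φ t p O gv) (fOf κ Φ t p O fv) mk qxY WxY)) (kgWp₂Y (nL κ Φ t p O.merged (gOf κ Φ t p O gv) (fOf κ Φ t p O fv)) (vL κ Φ t p O.merged (gOf κ Φ t p O gv) (fOf κ Φ t p O fv)) (KS0.R'0 κ Φ t p O.merged mk) 0 (kgWY κ Φ t p O.merged (gOf κ Φ t p O gv) (fOf κ Φ t p O fv) (KS.WxYR κ Φ t p O.merged mk (gOf κ Φ t p O gv) (fOf κ Φ t p O fv) WxY)) (kgNYv0 κ Φ t p O.merged (gOf κ Φ t p O gv) (fOf κ Φ t p O fv) mk qxY WxY)) (kgM₂Y (nL κ Φ t p O.merged (gOf κ Φ t p O gv) (fOf κ Φ t p O fv)) (ℓL κ Φ t p O.merged (gOf κ Φ t p O gv) (fOf κ Φ t p O fv)) (hL κ Φ t p O.merged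 (gOf κ Φ t p O gv) (fOf κ Φ t p O fv)) (vL κ Φ t p O.merged (gOf κ Φ t p O gv) (fOf κ Φ t p O fv)) (KS0.R'0 κ Φ t p O.merged mk) 0 (kgqY κ Φ t p O.merged (gOf κ Φ t p O gv) (fOf κ Φ t p O fv) qxY) (kgWY κ Φ t p O.merged (gOf κ Φ t p O gv) (fOf κ Φ t p O fv) (KS.WxYR κ Φ t p O.merged mk (gOf κ Φ t p O gv) (fOf κ Φ t p O fv) WxY)) (kgNYv0 κ Φ t p O.merged (gOf κ Φ t p O gv) (fOf κ Φ t p O fv) mk qxY WxY))) + (kgZY₁ (nL κ Φ t p O.merged (gOf κ Φ t p O gv) (fOf κ Φ t p O fv)) (ℓL κ Φ t p O.merged (gOf κ Φ t p O gv) (fOf κ Φ t p O fv)) (hL κ Φ t p O.merged (gOf κ Φ t p O gv) (fOf κ Φ t p O fv)) (KS0.R'0 κ Φ t p O.merged mk) 0 (kgqY κ Φ t p O.merged (gOf κ Φ t p O gv) (fOf κ Φ t p O fv) qxY) (kgNYv0 κ Φ t p O.merged (gOf κ Φ t p O gv) (fOf κ Φ t p O fv) mk qxY WxY) (kgM₁Y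 (nL κ Φ t p O.merged (gOf κ Φ t p O gv) (fOf κ Φ t p O fv)) (vL κ Φ t p O.merged (gOf κ Φ t p O gv) (fOf κ Φ t p O fv)) (KS0.R'0 κ Φ t p O.merged mk) 0 (kgWY κ Φ t p O.merged (gOf κ Φ t p O gv) (fOf κ Φ t p O fv) (KS.WxYR κ Φ t p O.merged mk (gOf κ Φ t p O gv) (fOf κ Φ t p O fv) WxY)) (kgNYv0 κ Φ t p O.merged (gOf κ Φ t p O gv) (fOf κ Φ t p O fv) mk qxY WxY)) (kgM₂Y (nL κ Φ t p O.merged (gOf κ Φ t p O gv) (fOf κ Φ t p O fv)) (ℓL κ Φ t p O.merged (gOf κ Φ t p O gv) (fOf κ Φ t p O fv)) (hL κ Φ t p O.merged (gOf κ Φ t p O gv) (fOf κ Φ t p O fv)) (vL κ Φ t p O.merged (gOf κ Φ t p O gv) (fOf κ Φ t p O fv)) (KS0.R'0 κ Φ t p O.merged mk) 0 (kgqY κ Φ t p O.merged (gOf κ Φ t p O gv) (fOf κ Φ t p O fv) qxY) (kgWY κ Φ t p O.merged (gOf κ Φ t p O gv) (fOf κ Φ t p O fv) (KS.WxYR κ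 Φ t p O.merged mk (gOf κ Φ t p O gv) (fOf κ Φ t p O fv) WxY)) (kgNYv0 κ Φ t p O.merged (gOf κ Φ t p O gv) (fOf κ Φ t p O fv) mk qxY WxY)))) ≤ (Rπ κ Φ t p O.merged (gOf κ Φ t p O gv) (fOf κ Φ t p O fv) (SUS ex mx) q) := by
    have h1 : ((KS.D2R κ Φ t p O.merged mk (gOf κ Φ t p O gv) (fOf κ Φ t p O fv) WxY : ℕ) : ℤ) + (ZY : ℤ) + 13 * ((nL κ Φ t p O.merged (gOf κ Φ t p O gv) (fOf κ Φ t p O fv)) : ℤ) ≤ (Rπ κ Φ t p O.merged (gOf κ Φ t p O gv) (fOf κ Φ t p O fv) (SUS ex mx) q) := by exact_mod_cast hYπ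
    have e : ((10 : ℤ) + 3) = 13 := by norm_num
    rw [e]
    unfold kgR at hreachY
    linarith
  -- assemble: the skeleton at the values of record
  have HKx := kgRows0_of κ Φ t p O.merged (gOf κ Φ t p O gv) (fOf κ Φ t p O fv) mk 0 0 (eqNumL_of_atQ (atQ3_of_atQ3V hAt)) hgK
  have HKy := kgYRows0_of κ Φ t p O.merged (gOf κ Φ t p O gv) (fOf κ Φ t p O fv) mk qxY (KS.WxYR κ Φ t p O.merged mk (gOf κ Φ t p O gv) (fOf κ Φ t p O fv) WxY) (eqNumL_of_atQ (atQ3_of_atQ3V hAt)) hgK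
  have hmain := rootLegAt_frmQ3KV_snd LfQ hAt h1 hp0 hp1 mk HKx 30 HKy (kgNYv0 κ Φ t p O.merged (gOf κ Φ t p O gv) (fOf κ Φ t p O fv) mk qxY WxY)
    (Rb := KS.RB0 κ Φ t p O.merged mk) hr₀R hr₀bR
    (hRQ_RT κ Φ t p O.merged (gOf κ Φ t p O gv) (fOf κ Φ t p O fv) (cOf κ Φ t p O gv fv cv) (SUS ex mx) q)
    (hRB_RT κ Φ t p O.merged (gOf κ Φ t p O gv) (fOf κ Φ t p O fv) (cOf κ Φ t p O gv fv cv) (SUS ex mx) q _)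
    (hRQ'_RT κ Φ t p O.merged (gOf κ Φ t p O gv) (fOf κ Φ t p O fv) (cOf κ Φ t p O gv fv cv) (SUS ex mx) q _)
    (hRM_RT κ Φ t p O.merged (gOf κ Φ t p O gv) (fOf κ Φ t p O fv) (cOf κ Φ t p O gv fv cv) (SUS ex mx) q _)
    (fat_le_Rπ κ Φ t p O.merged (gOf κ Φ t p O gv) (fOf κ Φ t p O fv) ex mx q hC)
    (fun i => by rw [fcellsV_r]; exact hRs5 i)
    (hkR_hop_prism κ Φ t p O.merged (gOf κ Φ t p O gv) (fOf κ Φ t p O fv) hN)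
    (by
      have h := hfR_hop_snd κ Φ t p O.merged (gOf κ Φ t p O gv) (fOf κ Φ t p O fv) hN
        (c₁ := (fcellsV κ Φ t p O.merged (gOf κ Φ t p O gv) (fOf κ Φ t p O fv) (cOf κ Φ t p O gv fv cv) (hOf κ Φ t p O gv fv hv)).c 1) ((fcellsV κ Φ t p O.merged (gOf κ Φ t p O gv) (fOf κ Φ t p O fv) (cOf κ Φ t p O gv fv cv) (hOf κ Φ t p O gv fv hv)).hcr 1)
      simpa only [fcellsV_r] using h)
    c₁ hc₁ hRD hnR hrow
    (by rw [hX1]; exact KS.hX₁_0 κ Φ t p O.merged mk (gOf κ Φ t p O gv) (fOf κ Φ t p O fv) _)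
    c₂ hc₂ hRD₃
    (KS.B0 κ Φ t p O.merged mk (gOf κ Φ t p O gv) (fOf κ Φ t p O fv)) (B0_ok_of_atQ3 hAt' mk)
    (KS.B0_lo_le_hi κ Φ t p O.merged mk (gOf κ Φ t p O gv) (fOf κ Φ t p O fv))
    (KS.R'0_le_B0_R' κ Φ t p O.merged mk (gOf κ Φ t p O gv) (fOf κ Φ t p O fv))
    (KS.B0_core1_le κ Φ t p O.merged mk (gOf κ Φ t p O gv) (fOf κ Φ t p O fv) hℓB3) hc1R
    (KS.hhopB_0 κ Φ t p O.merged mk (gOf κ Φ t p O gv) (fOf κ Φ t p O fv) _ _ hn1)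
    (KS.hclear₁_0_of_floor κ Φ t p O.merged mk (gOf κ Φ t p O gv) (fOf κ Φ t p O fv) hf)
    _ _ hQb hFb hbridge
    hfoot₁ (hfoot₂ c₁ hX1 hY1) (hfoot₃ c₂ hX2 hY2)
    (fun k hk w _ hw => KS.hclear₃_RW κ Φ t p O.merged mk (gOf κ Φ t p O gv) (fOf κ Φ t p O fv) qxY WxY hN hgK hg2 hgR hWxY hqx20 h0Y hXY hX2 hY2 k hk w hw)
    (fun w _ hw => KS.hx_0s κ Φ t p O.merged mk (gOf κ Φ t p O gv) (fOf κ Φ t p O fv) _ hN HKx 30 hW hRq hX1 hY1 hw)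
    (fun w _ hw => KS.hx₂_R κ Φ t p O.merged mk (gOf κ Φ t p O gv) (fOf κ Φ t p O fv) qxY WxY hN hgK hg2 hf hWxY hWx45 hq3 hX1 hY1 hX2 hY2 hw)
    (hlastf c₂ hX2 hY2)
    hDm
    (hR₁_US κ Φ t p O.merged (gOf κ Φ t p O gv) (fOf κ Φ t p O fv) ex mx q hCq (oL κ Φ t p O.D O.DT.toDataN O.ori (gOf κ Φ t p O gv) (fOf κ Φ t p O fv)) hη t
      (Skelφ.fatRadius Φ.frame hC O.merged.k))
    (SRex_fat_le_Rπ_sub κ Φ t p O.merged (gOf κ Φ t p O gv) (fOf κ Φ t p O fv) ex mx q hC hexRB)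
    (SRex_fat_le_Rπ_sub κ Φ t p O.merged (gOf κ Φ t p O gv) (fOf κ Φ t p O fv) ex mx q hC hexRL)
    (by
      rw [ChainPlanar.BridgePrm.bridgeFrame_N]
      exact KS.hlen_R2 κ Φ t p O.merged mk (gOf κ Φ t p O gv) (fOf κ Φ t p O fv) qxY WxY hN hgK hg2 hxY)
  exact hmain

end NegB

end PlanarSkeletonFrm

end Transplant

end Summit.CriticalPhenomena.PercolationContinuityZ3.Theorems

end
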